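import Mathlib
import Summits.KontsevichZagierPeriods.KontsevichZagierPeriods.Theorems.IsogenyCertificatesJLPairBranches
import HarnessLib

/-!
# The Jacquet–Langlands correspondence for `X_0^{35}`: calculus of the real branches

Support file for `JLPairIdentityX` (stmt-KontsevichZagierPeriods-14655): derivatives
(`HasDerivAt xb (dxb u) u`, `HasDerivAt xt (dxt u) u` on `(−∞,−1]`), continuity, the end-point values
`x_b(−1) = 0`, `x_t(−1) = −4/9`, the turning point `u_m` of the tiny branch (DEFINED as the zero of
`R_c` in `(−43/20, −213/100)`, unique on `(−∞,−1)`), and strict monotonicity: `x_b` increasing on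
`(−∞,−1)`, `x_t` increasing on `(−∞,u_m]` and decreasing on `[u_m,−1]`.
-/

namespace Summit.KontsevichZagierPeriods.IsogenyCertificates.JLPair

open Literature.Algebra.Polynomial

/-! ### Derivatives, continuity, the turning point `u_m`, monotonicity -/

section Calculus

open Set Filter Topology

/-- `x_b` has derivative `x_b'` on `(−∞,−1]` (quotient rule on `(P₁ + √disc)/(2Q)` and the
identity `disc' = 2P₁P₁' − 4(Q'P₂ + QP₂')`). [folklore] -/
theorem hasDerivAt_xb {u : ℝ} (hu : u ≤ -1) : HasDerivAt xb (dxb u) u := by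
  have hQ := Q_pos hu
  have hD := D_pos hu
  have hs0 := sD_pos hu
  have hs := sD_sq hu
  have hP1 := CoeffList.hasDerivAt_eval u cP1
  have hQ' := CoeffList.hasDerivAt_eval u cQ
  have hP2 := CoeffList.hasDerivAt_eval u cP2
  have hDd := CoeffList.hasDerivAt_eval u cD
  have hsq : HasDerivAt (fun v => Real.sqrt (CoeffList.eval v cD))
      (CoeffList.eval u (CoeffList.derivList cD) / (2 * Real.sqrt (CoeffList.eval u cD))) u :=
    hDd.sqrt hD.ne'
  have hnum := hP1.add hsq
  have hden : HasDerivAt (fun v => 2 * CoeffList.eval v cQ) (2 * CoeffList.eval u (CoeffList.derivList cQ)) u :=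
    hQ'.const_mul 2
  have hdiv := hnum.div hden (mul_ne_zero two_ne_zero hQ.ne')
  have key : HasDerivAt xb
      (((CoeffList.eval u (CoeffList.derivList cP1) +
            CoeffList.eval u (CoeffList.derivList cD) / (2 * Real.sqrt (CoeffList.eval u cD))) *
          (2 * CoeffList.eval u cQ) -
        (CoeffList.eval u cP1 + Real.sqrt (CoeffList.eval u cD)) *
          (2 * CoeffList.eval u (CoeffList.derivList cQ))) /
      (2 * CoeffList.eval u cQ) ^ 2) u := hdiv
  refine key.congr_deriv ?_
  -- algebra: the quotient-rule value equals `dxb u`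
  have hsD : Real.sqrt (CoeffList.eval u cD) = sD u := rfl
  rw [hsD, eval_derivList_cD]
  unfold dxb xb
  rw [eval_cD1, eval_cD2]
  field_simp
  linear_combination (-2 * CoeffList.eval u (CoeffList.derivList cQ)) * hs

/-- `x_t` has derivative `x_t'` on `(−∞,−1]`. [folklore] -/
theorem hasDerivAt_xt {u : ℝ} (hu : u ≤ -1) : HasDerivAt xt (dxt u) u := by
  have hQ := Q_pos hu
  have hD := D_pos hu
  have hs0 := sD_pos hu
  have hs := sD_sq hu
  have hP1 := CoeffList.hasDerivAt_eval u cP1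
  have hQ' := CoeffList.hasDerivAt_eval u cQ
  have hDd := CoeffList.hasDerivAt_eval u cD
  have hsq : HasDerivAt (fun v => Real.sqrt (CoeffList.eval v cD))
      (CoeffList.eval u (CoeffList.derivList cD) / (2 * Real.sqrt (CoeffList.eval u cD))) u :=
    hDd.sqrt hD.ne'
  have hnum := hP1.sub hsq
  have hden : HasDerivAt (fun v => 2 * CoeffList.eval v cQ) (2 * CoeffList.eval u (CoeffList.derivList cQ)) u :=
    hQ'.const_mul 2
  have hdiv := hnum.div hden (mul_ne_zero two_ne_zero hQ.ne')
  have key : HasDerivAt xt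
      (((CoeffList.eval u (CoeffList.derivList cP1) -
            CoeffList.eval u (CoeffList.derivList cD) / (2 * Real.sqrt (CoeffList.eval u cD))) *
          (2 * CoeffList.eval u cQ) -
        (CoeffList.eval u cP1 - Real.sqrt (CoeffList.eval u cD)) *
          (2 * CoeffList.eval u (CoeffList.derivList cQ))) /
      (2 * CoeffList.eval u cQ) ^ 2) u := hdiv
  refine key.congr_deriv ?_
  have hsD : Real.sqrt (CoeffList.eval u cD) = sD u := rfl
  rw [hsD, eval_derivList_cD]
  unfold dxt xt
  rw [eval_cD1, eval_cD2]
  field_simp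
  linear_combination (2 * CoeffList.eval u (CoeffList.derivList cQ)) * hs

/-- `x_b` is continuous on `(−∞,−1]`. [folklore] -/
theorem continuousOn_xb : ContinuousOn xb (Iic (-1)) :=
  fun _ hu => (hasDerivAt_xb hu).continuousAt.continuousWithinAt

/-- `x_t` is continuous on `(−∞,−1]`. [folklore] -/
theorem continuousOn_xt : ContinuousOn xt (Iic (-1)) :=
  fun _ hu => (hasDerivAt_xt hu).continuousAt.continuousWithinAt

/-- End-point values: `√disc(−1) = −P₁(−1)`, so `x_b(−1) = 0` and `x_t(−1) = −4/9`. [folklore] -/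
theorem xb_neg_one : xb (-1) = 0 := by
  obtain ⟨hQ, hP1, hP2⟩ := eval_neg_one
  have hs : sD (-1) = 65883440 := by
    unfold sD
    rw [eval_cD, hP1, hQ, hP2]
    rw [show ((-65883440 : ℝ) ^ 2 - 4 * 148237740 * 0) = (65883440 : ℝ) ^ 2 by norm_num]
    exact Real.sqrt_sq (by norm_num)
  unfold xb; rw [hs, hP1, hQ]; norm_num

/-- See `xb_neg_one`. [folklore] -/
theorem xt_neg_one : xt (-1) = -4 / 9 := by
  obtain ⟨hQ, hP1, hP2⟩ := eval_neg_one
  have hs : sD (-1) = 65883440 := by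
    unfold sD
    rw [eval_cD, hP1, hQ, hP2]
    rw [show ((-65883440 : ℝ) ^ 2 - 4 * 148237740 * 0) = (65883440 : ℝ) ^ 2 by norm_num]
    exact Real.sqrt_sq (by norm_num)
  unfold xt; rw [hs, hP1, hQ]; norm_num

/-- `x_b` is strictly increasing on `(−∞, −1)`. [folklore] -/
theorem strictMonoOn_xb : StrictMonoOn xb (Iio (-1)) :=
  strictMonoOn_of_deriv_pos (convex_Iio _) (continuousOn_xb.mono Iio_subset_Iic_self) fun u hu => by
    rw [interior_Iio] at hu
    rw [(hasDerivAt_xb (le_of_lt hu)).deriv]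
    exact dxb_pos (le_of_lt hu)

/-! #### The turning point `u_m` of the tiny branch -/

/-- `R_c` (as a real function) has derivative `R_c'`. [folklore] -/
theorem hasDerivAt_Rc (u : ℝ) :
    HasDerivAt (fun v => CoeffList.eval v cRc) (CoeffList.eval u (CoeffList.derivList cRc)) u :=
  CoeffList.hasDerivAt_eval u cRc

/-- `R_c` is continuous. [folklore] -/
theorem continuous_Rc : Continuous fun v : ℝ => CoeffList.eval v cRc :=
  continuous_iff_continuousAt.mpr fun u => (hasDerivAt_Rc u).continuousAt

/-- `R_c` is strictly increasing on `[−43/20, −213/100]`. [folklore] -/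
theorem strictMonoOn_Rc : StrictMonoOn (fun v : ℝ => CoeffList.eval v cRc) (Icc (-43 / 20) (-213 / 100)) :=
  strictMonoOn_of_deriv_pos (convex_Icc _ _) continuous_Rc.continuousOn fun u hu => by
    rw [interior_Icc] at hu
    rw [(hasDerivAt_Rc u).deriv]
    exact dRc_pos hu.1.le hu.2

/-- `R_c` has a zero in `(−43/20, −213/100)`. [folklore] -/
theorem exists_root_Rc : ∃ u ∈ Ioo (-43 / 20 : ℝ) (-213 / 100), CoeffList.eval u cRc = 0 := by
  have h1 : CoeffList.eval (-43 / 20 : ℝ) cRc < 0 := Rc_neg_of_le le_rfl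
  have h2 : 0 < CoeffList.eval (-213 / 100 : ℝ) cRc := Rc_pos_of_ge le_rfl (by norm_num)
  have := intermediate_value_Ioo (by norm_num : (-43 / 20 : ℝ) ≤ -213 / 100) continuous_Rc.continuousOn
  exact this ⟨h1, h2⟩

/-- The turning point `u_m ≈ −2.1420517` of the tiny branch: the zero of `R_c` in
`(−43/20, −213/100)` (unique on `(−∞,−1)`). [evidence: stmt-KontsevichZagierPeriods-14655 REPORT.md §4] -/
noncomputable def um : ℝ := Classical.choose exists_root_Rc

/-- `u_m ∈ (−43/20, −213/100)`. [folklore] -/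
theorem um_mem : um ∈ Ioo (-43 / 20 : ℝ) (-213 / 100) := (Classical.choose_spec exists_root_Rc).1

/-- `R_c(u_m) = 0`. [folklore] -/
theorem Rc_um : CoeffList.eval um cRc = 0 := (Classical.choose_spec exists_root_Rc).2

/-- `u_m < −1`. [folklore] -/
theorem um_lt : um < -1 := by linarith [um_mem.2]

/-- Sign of `R_c` on `(−∞,−1)`: negative exactly to the left of `u_m`. [folklore] -/
theorem Rc_neg_iff {u : ℝ} (hu : u < -1) : CoeffList.eval u cRc < 0 ↔ u < um := by
  have hm := um_mem
  constructor
  · intro h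
    by_contra hle; rw [not_lt] at hle
    -- um ≤ u < -1
    rcases le_or_gt u (-213 / 100) with h2 | h2
    · -- both in the monotonicity interval
      have hmono := strictMonoOn_Rc.monotoneOn ⟨hm.1.le, hm.2.le⟩ ⟨by linarith [hm.1], h2⟩ hle
      rw [Rc_um] at hmono
      linarith
    · linarith [Rc_pos_of_ge h2.le hu]
  · intro h
    rcases le_or_gt u (-43 / 20) with h1 | h1
    · exact Rc_neg_of_le h1
    · have := strictMonoOn_Rc ⟨h1.le, by linarith [hm.2]⟩ ⟨hm.1.le, hm.2.le⟩ h
      simp only at this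
      rwa [Rc_um] at this

/-- Sign of `R_c` on `(−∞,−1)`: positive exactly to the right of `u_m`. [folklore] -/
theorem Rc_pos_iff {u : ℝ} (hu : u < -1) : 0 < CoeffList.eval u cRc ↔ um < u := by
  have hm := um_mem
  constructor
  · intro h
    by_contra hle; rw [not_lt] at hle
    rcases lt_or_ge u (-43 / 20) with h1 | h1
    · linarith [Rc_neg_of_le h1.le]
    · have hmono := strictMonoOn_Rc.monotoneOn ⟨h1, by linarith [hm.2]⟩ ⟨hm.1.le, hm.2.le⟩ hle
      rw [Rc_um] at hmono
      linarith
  · intro h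
    rcases lt_or_ge u (-213 / 100) with h2 | h2
    · have := strictMonoOn_Rc ⟨hm.1.le, hm.2.le⟩ ⟨by linarith [hm.1], h2.le⟩ h
      simp only at this
      rwa [Rc_um] at this
    · exact Rc_pos_of_ge h2 hu

/-- `x_t' > 0` on `(−∞, u_m)` and `x_t' < 0` on `(u_m, −1)`. [folklore] -/
theorem dxt_pos {u : ℝ} (hu : u < um) : 0 < dxt u :=
  dxt_pos_of_Rc_neg (by linarith [um_lt]) ((Rc_neg_iff (hu.trans um_lt)).mpr hu)

/-- See `dxt_pos`. [folklore] -/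
theorem dxt_neg {u : ℝ} (hu1 : um < u) (hu2 : u < -1) : dxt u < 0 :=
  dxt_neg_of_Rc_pos hu2.le ((Rc_pos_iff hu2).mpr hu1)

/-- `x_t` is strictly increasing on `(−∞, u_m]`. [folklore] -/
theorem strictMonoOn_xt : StrictMonoOn xt (Iic um) :=
  strictMonoOn_of_deriv_pos (convex_Iic _)
    (continuousOn_xt.mono (Iic_subset_Iic.mpr um_lt.le)) fun u hu => by
    rw [interior_Iic] at hu
    rw [(hasDerivAt_xt (le_of_lt (lt_trans hu um_lt))).deriv]
    exact dxt_pos hu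

/-- `x_t` is strictly decreasing on `[u_m, −1]`. [folklore] -/
theorem strictAntiOn_xt : StrictAntiOn xt (Icc um (-1)) :=
  strictAntiOn_of_deriv_neg (convex_Icc _ _)
    (continuousOn_xt.mono Icc_subset_Iic_self) fun u hu => by
    rw [interior_Icc] at hu
    rw [(hasDerivAt_xt hu.2.le).deriv]
    exact dxt_neg hu.1 hu.2

end Calculus

end Summit.KontsevichZagierPeriods.IsogenyCertificates.JLPair
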